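import Literature.NumberTheory.Connes2026.SemilocalCutoffConjugation
import Literature.Analysis.OperatorTheory.HilbertSchmidtPairing
import HarnessLib

/-!
# Connes 1999 Thm VII.4, `k = ℚ`, `S = {∞} ∪ P` — REMOVING THE CUTOFFS IN THE LIMIT: `P_M → 1` and
# `P̂⁰_M → 1` strongly as `M → ∞`, and the limit of a Hilbert–Schmidt pairing `Σ_i ⟨A f_i, P̂⁰_M B f_i⟩ → Σ_i ⟨A f_i, B f_i⟩`

LABEL (line 1): RH-FREE literature (theorems only; NO definition, NO named fact).  bears_on: LADDER-RH
W-C/W-P (C1 named-fact debt), cell `rh-crit`, sub-cell cc, overflow row O1 — green layer under the row's last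
named fact `Connes1999_thm_VII_4_rat` (the cases `P ≠ ∅`), fifth file of the "annulus road"
(`SemilocalCutoffConjugation`, `AnnulusScalingSupport`, `SemilocalCutoffTraceReduction`,
`AnnulusCorrectionExpansion`; toolkit `Analysis/OperatorTheory/HilbertSchmidtPairing`).  WHAT THIS IS NOT:
any claim about positivity, Weil's criterion or RH — strong convergence of cutoff projections and a dominated
convergence step; nothing here bears on the truth of RH.

Sources.  A. Connes, Selecta Math. 5 (1999) [`Connes1999`], §VII (12)–(13) and Thm VII.4 ("when `Λ → ∞`";
held text `paper:arxiv-math_9811068`, p0013); M. Reed, B. Simon, *Methods of Modern Mathematical Physics I*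
(1972) [`ReedSimon1972`], Thm. VI.22 (e) (the Hilbert–Schmidt pairing).

## What is proved

With `P_M = cutoffProj M` (Connes 2026 namespace), `P̂⁰_M = dualCutoffProj ∅ M = 𝓕 P_M 𝓕⁻¹`:

* `norm_sq_sub_cutoffProj_eq_integral` — `‖y − P_M y‖² = ∫_{|v| > M} ‖y(v)‖² dv`;
* **`tendsto_cutoffProj_atTop`** — `P_M y → y` as `M → ∞` for every `y ∈ L²(ℝ)` (dominated convergence);
* **`tendsto_dualCutoffProj_empty_atTop`** — `P̂⁰_M x → x` as `M → ∞` (`𝓕`, `𝓕⁻¹` are continuous);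
  `norm_dualCutoffProj_empty_le` — `‖P̂⁰_M x‖ ≤ ‖x‖`;
* **`tendsto_tsum_inner_dualCutoffProj_empty`** — for bounded `A, B : L²(ℝ) → L²(ℝ)` that are
  Hilbert–Schmidt along a Hilbert basis `(f_i)` of a closed subspace (e.g. `L²(ℝ)_ev`), the pairing
  `Σ_i ⟨A f_i, P̂⁰_M B f_i⟩` tends to `Σ_i ⟨A f_i, B f_i⟩` as `M → ∞` (Tannery / dominated convergence for
  series with the summable majorant `‖A f_i‖‖B f_i‖` of `HilbertSchmidtPairing`).  This is the step
  "`P̂⁰_M → 1`" that turns the annulus-localised pieces `ϑ(g) P̂⁰_M Q₀ …` of the semilocal cutoff trace into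
  their cutoff-free limits `ϑ(g) Q₀ …`, whose traces are the local terms `∫′_{ℚ_p^*}`.

No instance, notation or attribute; no `def`.
-/

noncomputable section

open _root_.MeasureTheory Complex Set Filter
open scoped Real Topology ComplexConjugate ENNReal InnerProductSpace

namespace Literature.NumberTheory.Connes2026

open Literature.NumberTheory.LFunctions Literature.Analysis.OperatorTheory
open Literature.NumberTheory.ConnesConsani2024
open Literature.NumberTheory.ConnesConsani2021

/-! ## §1. `P_M → 1` strongly -/

section Cutoff

/-- `‖f‖²_{L²} = ∫ ‖f(v)‖² dv` for `f ∈ L²(ℝ)`. [folklore] -/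
private theorem norm_sq_eq_integral (f : Lp ℂ 2 (volume : Measure ℝ)) : ‖f‖ ^ 2 = ∫ v, ‖(f : ℝ → ℂ) v‖ ^ 2 := by
  rw [← inner_self_eq_norm_sq (𝕜 := ℂ) f, MeasureTheory.L2.inner_def,
    ← integral_re (MeasureTheory.L2.integrable_inner (𝕜 := ℂ) f f)]
  exact integral_congr_ae (Eventually.of_forall fun x => inner_self_eq_norm_sq (𝕜 := ℂ) ((f : ℝ → ℂ) x))

/-- **`‖y − P_M y‖² = ∫ 1_{|v| > M} ‖y(v)‖² dv`** (the mass of `y` outside the cutoff). [cite: Connes1999, §VII eq. (12) (arXiv p0013)] -/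
theorem norm_sq_sub_cutoffProj_eq_integral (M : ℝ) (y : Lp ℂ 2 (volume : Measure ℝ)) :
    ‖y - cutoffProj M y‖ ^ 2 = ∫ v, (Icc (-M) M)ᶜ.indicator (fun v => ‖(y : ℝ → ℂ) v‖ ^ 2) v := by
  rw [norm_sq_eq_integral]
  refine integral_congr_ae ?_
  filter_upwards [Lp.coeFn_sub y (cutoffProj M y), cutoffProj_coeFn M y] with v h1 h2
  rw [h1, Pi.sub_apply, h2]
  by_cases hv : v ∈ Icc (-M) M
  · rw [Set.indicator_of_mem hv, Set.indicator_of_notMem (Set.notMem_compl_iff.mpr hv), sub_self, norm_zero,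
      zero_pow two_ne_zero]
  · rw [Set.indicator_of_notMem hv, Set.indicator_of_mem (Set.mem_compl hv), sub_zero]

/-- `∫ 1_{|v|>M} ‖y‖² → 0` as `M → ∞` (dominated convergence, `‖y‖² ∈ L¹`). [folklore] -/
private theorem tendsto_integral_indicator_compl_Icc (y : Lp ℂ 2 (volume : Measure ℝ)) :
    Tendsto (fun M : ℝ => ∫ v, (Icc (-M) M)ᶜ.indicator (fun v => ‖(y : ℝ → ℂ) v‖ ^ 2) v) atTop (𝓝 0) := by
  have hint : Integrable (fun v => ‖(y : ℝ → ℂ) v‖ ^ 2) :=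
    (memLp_two_iff_integrable_sq_norm (Lp.memLp y).1).1 (Lp.memLp y)
  have h0 : (0 : ℝ) = ∫ v : ℝ, (fun _ => (0 : ℝ)) v := by simp
  rw [h0]
  refine tendsto_integral_filter_of_dominated_convergence (fun v => ‖(y : ℝ → ℂ) v‖ ^ 2) ?_ ?_ hint ?_
  · exact Eventually.of_forall fun M =>
      (hint.aestronglyMeasurable.indicator (measurableSet_Icc.compl))
  · refine Eventually.of_forall fun M => Eventually.of_forall fun v => ?_
    rw [Real.norm_eq_abs, abs_of_nonneg (Set.indicator_nonneg (fun _ _ => sq_nonneg _) v)]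
    exact Set.indicator_le_self' (fun _ _ => sq_nonneg _) v
  · refine Eventually.of_forall fun v => ?_
    -- for `M ≥ |v|` the indicator vanishes
    refine tendsto_const_nhds.congr' ?_
    filter_upwards [eventually_ge_atTop |v|] with M hM
    have hv : v ∈ Icc (-M) M := abs_le.mp hM
    rw [Set.indicator_of_notMem (Set.notMem_compl_iff.mpr hv)]

/-- **`P_M y → y` as `M → ∞`** for every `y ∈ L²(ℝ)` (the infrared cutoff tends strongly to the identity;
Connes 1999 Thm VII.4 is an asymptotic statement "when `Λ → ∞`"). [cite: Connes1999, §VII eq. (12) and Thm 4 (arXiv p0013)] -/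
theorem tendsto_cutoffProj_atTop (y : Lp ℂ 2 (volume : Measure ℝ)) :
    Tendsto (fun M : ℝ => cutoffProj M y) atTop (𝓝 y) := by
  rw [tendsto_iff_norm_sub_tendsto_zero]
  have h1 : Tendsto (fun M : ℝ => ‖y - cutoffProj M y‖ ^ 2) atTop (𝓝 0) := by
    simp_rw [norm_sq_sub_cutoffProj_eq_integral]
    exact tendsto_integral_indicator_compl_Icc y
  have h2 : Tendsto (fun M : ℝ => Real.sqrt (‖y - cutoffProj M y‖ ^ 2)) atTop (𝓝 (Real.sqrt 0)) :=
    h1.sqrt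
  rw [Real.sqrt_zero] at h2
  refine h2.congr fun M => ?_
  rw [Real.sqrt_sq (norm_nonneg _), norm_sub_rev]

end Cutoff

/-! ## §2. `P̂⁰_M → 1` strongly -/

section DualCutoff

/-- `‖P̂⁰_M x‖ ≤ ‖x‖` (`𝓕`, `𝓕⁻¹` are isometries, `‖P_M‖ ≤ 1`). [cite: Connes1999, §VII eq. (13) (arXiv p0013)] -/
theorem norm_dualCutoffProj_empty_le (M : ℝ) (x : Lp ℂ 2 (volume : Measure ℝ)) :
    ‖dualCutoffProj ∅ M x‖ ≤ ‖x‖ := by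
  rw [dualCutoffProj_empty, mul_apply_eq_comp, mul_apply_eq_comp]
  calc ‖fourierL2 (cutoffProj M (fourierL2Inv x))‖ = ‖cutoffProj M (fourierL2Inv x)‖ :=
        (Lp.fourierTransformₗᵢ ℝ ℂ).norm_map _
    _ ≤ ‖fourierL2Inv x‖ := norm_cutoffProj_le M _
    _ = ‖x‖ := (Lp.fourierTransformₗᵢ ℝ ℂ).symm.norm_map x

/-- **`P̂⁰_M x → x` as `M → ∞`** for every `x ∈ L²(ℝ)` (from `P_M → 1` and the continuity of `𝓕`). [cite: Connes1999, §VII eq. (13) and Thm 4 (arXiv p0013)] -/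
theorem tendsto_dualCutoffProj_empty_atTop (x : Lp ℂ 2 (volume : Measure ℝ)) :
    Tendsto (fun M : ℝ => dualCutoffProj ∅ M x) atTop (𝓝 x) := by
  have h1 := tendsto_cutoffProj_atTop (fourierL2Inv x)
  have h2 : Tendsto (fun M : ℝ => fourierL2 (cutoffProj M (fourierL2Inv x))) atTop (𝓝 (fourierL2 (fourierL2Inv x))) :=
    (fourierL2.continuous.tendsto _).comp h1
  have h3 : fourierL2 (fourierL2Inv x) = x :=
    congrArg (fun T : Lp ℂ 2 (volume : Measure ℝ) →L[ℂ] Lp ℂ 2 (volume : Measure ℝ) => T x)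
      fourierL2_mul_fourierL2Inv
  rw [h3] at h2
  refine h2.congr fun M => ?_
  rw [dualCutoffProj_empty, mul_apply_eq_comp, mul_apply_eq_comp]

end DualCutoff

/-! ## §3. The limit of a Hilbert–Schmidt pairing through `P̂⁰_M → 1` -/

section Pairing

/-- **`Σ_i ⟨A f_i, P̂⁰_M B f_i⟩ → Σ_i ⟨A f_i, B f_i⟩` as `M → ∞`**, for bounded `A, B` on `L²(ℝ)` that are
Hilbert–Schmidt along a family `(f_i)` (`Σ‖A f_i‖², Σ‖B f_i‖² < ∞`; typically a Hilbert basis of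
`L²(ℝ)_ev`): dominated convergence for the series with the summable majorant `‖A f_i‖‖B f_i‖`, the termwise
limit being `P̂⁰_M → 1` strongly.  This is how the cutoff is removed from the annulus-localised pieces of
`Tr(ϑ(g) R_Λ^S)` once they are written as pairings of Hilbert–Schmidt factors. [cite: Connes1999, §VII Thm 4 ("when `Λ → ∞`", arXiv p0013); ReedSimon1972, Thm. VI.22 (e), PDF p. 198] -/
theorem tendsto_tsum_inner_dualCutoffProj_empty {ι : Type*} (f : ι → Lp ℂ 2 (volume : Measure ℝ))
    (A B : Lp ℂ 2 (volume : Measure ℝ) →L[ℂ] Lp ℂ 2 (volume : Measure ℝ))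
    (hA : Summable fun i => ‖A (f i)‖ ^ 2) (hB : Summable fun i => ‖B (f i)‖ ^ 2) :
    Tendsto (fun M : ℝ => ∑' i, ⟪A (f i), dualCutoffProj ∅ M (B (f i))⟫_ℂ) atTop
      (𝓝 (∑' i, ⟪A (f i), B (f i)⟫_ℂ)) := by
  refine tendsto_tsum_of_dominated_convergence (bound := fun i => ‖A (f i)‖ * ‖B (f i)‖)
    (summable_norm_mul_norm_of_sq hA hB) (fun i => ?_) (Eventually.of_forall fun M i => ?_)
  · exact ((continuous_inner (𝕜 := ℂ)).tendsto _).comp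
      (tendsto_const_nhds.prodMk_nhds (tendsto_dualCutoffProj_empty_atTop (B (f i))))
  · exact (norm_inner_le_norm _ _).trans
      (mul_le_mul_of_nonneg_left (norm_dualCutoffProj_empty_le M _) (norm_nonneg _))

/-- The same with the cutoff on the left factor: `Σ_i ⟨P̂⁰_M A f_i, B f_i⟩ → Σ_i ⟨A f_i, B f_i⟩`. [cite: Connes1999, §VII Thm 4 (arXiv p0013); ReedSimon1972, Thm. VI.22 (e), PDF p. 198] -/
theorem tendsto_tsum_inner_dualCutoffProj_empty_left {ι : Type*} (f : ι → Lp ℂ 2 (volume : Measure ℝ))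
    (A B : Lp ℂ 2 (volume : Measure ℝ) →L[ℂ] Lp ℂ 2 (volume : Measure ℝ))
    (hA : Summable fun i => ‖A (f i)‖ ^ 2) (hB : Summable fun i => ‖B (f i)‖ ^ 2) :
    Tendsto (fun M : ℝ => ∑' i, ⟪dualCutoffProj ∅ M (A (f i)), B (f i)⟫_ℂ) atTop
      (𝓝 (∑' i, ⟪A (f i), B (f i)⟫_ℂ)) := by
  refine tendsto_tsum_of_dominated_convergence (bound := fun i => ‖A (f i)‖ * ‖B (f i)‖)
    (summable_norm_mul_norm_of_sq hA hB) (fun i => ?_) (Eventually.of_forall fun M i => ?_)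
  · exact ((continuous_inner (𝕜 := ℂ)).tendsto _).comp
      ((tendsto_dualCutoffProj_empty_atTop (A (f i))).prodMk_nhds tendsto_const_nhds)
  · exact (norm_inner_le_norm _ _).trans
      (mul_le_mul_of_nonneg_right (norm_dualCutoffProj_empty_le M _) (norm_nonneg _))

end Pairing

end Literature.NumberTheory.Connes2026
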